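import Mathlib.Analysis.SpecialFunctions.Pow.Real
import HarnessLib

/-!
# Armstrong–Vicol's cascade of renormalised diffusivities (fractal homogenisation), Lemma 3.4

S. Armstrong, V. Vicol, *Anomalous diffusion by fractal homogenization*, Ann. PDE **11** (2025),
Paper No. 2 = arXiv:2305.05048v3, §2.1 (the parameters, p. 18–19) and §3.3 (the renormalised
diffusivities, pp. 42–45). [`ArmstrongVicol2025`]

The proof of Armstrong–Vicol's Theorem 1.1 (typed in `TurbPassiveScalar.lean` as `armstrong_vicol`,
`ArmstrongVicol2025_thm11_full`, `ArmstrongVicol2025_thm11_rate`) renormalises the advection–diffusion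
equation one scale at a time: the effective ("eddy") diffusivity `κₘ₋₁` seen at scale `εₘ₋₁` is the
homogenised coefficient `K̄ₘ^{κₘ}` of the scale-`εₘ` shear flows run with diffusivity `κₘ`, starting
from the molecular diffusivity `κ_M = κ` at the critical scale `ε_M` ((3.42) p. 43). Up to the
corrector error (3.40), `K̄ₘ^κ ≈ κ + 9 aₘ² εₘ⁴ / (80 κ)` ((3.41) p. 42: Taylor dispersion of a shear
flow of amplitude `aₘ = εₘ^{β-2}` and wavelength `εₘ`), and Lemma 3.4 (p. 43) controls the whole
finite sequence: `c aₘ εₘ^{2+γ} ≤ κₘ ≤ C aₘ εₘ^{2+γ}` with universal `0 < c < C` ((3.45)),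
PROVIDED the molecular diffusivity lies in the set of permissible diffusivities
`𝒦 = ⋃ₘ [½ εₘ^{2β/(q+1)}, 2 εₘ^{2β/(q+1)}]` ((3.43)–(3.44)) — "the reason we are only able to
obtain anomalous diffusion along a subsequence of `κ`'s in Theorem 1.1 is due to the restriction in
Lemma 3.4" (p. 45), a restriction which "does not appear to be a technical artifact of our proof, but
rather a property of the recursion itself" (p. 43).

## What is here (definitions only; no named facts — everything about them is PROVED in the
companion `RenormalizedDiffusivityCascadeProofs.lean`)

* The exponents of §2.1: `qExp β` ((2.2)), `gammaExp β q` ((2.7)), `deltaExp β q` ((2.5)). The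
  "routine" identities the paper uses without proof — (2.3), (2.4), the second form of (2.5),
  `δ ∈ (0, 1/16]`, `q (β - γ) = β + γ` (used at (3.52)), `2β/(q+1) = β - γ` (so that (3.44)
  reads `½ ε_M^{-2γ} ≲ s_M ≲ 2 ε_M^{-2γ}`, p. 44), `aₘ εₘ^{2+γ} = εₘ^{β+γ}` ((3.48)) — are
  theorems of the companion file.
* The MODEL recursion (3.47) `κ'ₘ₋₁ = κ'ₘ + 9 aₘ² εₘ⁴/(80 κ'ₘ)`, `κ'_M = κ`
  (`enhanceStep`, `modelDiffusivity`), over an abstract scale sequence `ε` satisfying exactly the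
  printed consequences (2.8)–(2.10) of the definition `εₘ⁻¹ = ⌈Λ^{q^m/(q-1)}⌉`, `Λ ≥ 2⁷`
  (`IsScaleSequence`: `ε₀ = 1`, `εₘ/εₘ₊₁ ≥ 2⁷`, `(1-10εₘ)εₘ^q ≤ εₘ₊₁ ≤ (1+10εₘ)εₘ^q` for `m ≥ 1`),
  and the printed sequence itself, `scaleBase Λ q m = Λ^{q^m/(q-1)}` and
  `scaleSeq Λ q m = εₘ = ⌈Λ^{q^m/(q-1)}⌉⁻¹` (`ε₀ = 1`) ((2.8)); that `scaleSeq Λ q` IS an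
  `IsScaleSequence q` — (2.9) always, (2.10) for `q < 10` and `Λ ≥ max{2⁷, 10(q+1)/(10-q)}` — is
  proved in `RenormalizedDiffusivityCascadeScales.lean` (see there for why `q < 10` is needed for
  the printed constant `10`).
* **Step 1 of the proof of Lemma 3.4, (3.49) p. 44** is the companion's
  `modelDiffusivity_bounds`: there are constants `0 < c ≤ C` depending only on `β` and `q` such
  that for EVERY such scale sequence, every critical scale `M` and every `κ` in the window (3.44),
  `c aₘ εₘ^{2+γ} ≤ κ'ₘ ≤ C aₘ εₘ^{2+γ}` for all `1 ≤ m ≤ M - 1`. The proof is the printed one: the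
  rescaled variable `sₘ = κ'ₘ √(80/9) / (aₘ εₘ^{2+γ})` ((3.50)) obeys
  `sₘ₋₁ = rₘ (sₘ εₘ^{2γ} + 1/sₘ)` with `rₘ = (εₘ/εₘ₋₁^q)^{β-γ}` ((3.51)–(3.52)),
  `max{sₘ₋₁, 1/sₘ₋₁} ≤ max{rₘ,1/rₘ}(1+εₘ^{2γ}) max{sₘ,1/sₘ}` (the display before (3.54)), the
  first step lands in a universal window, and the product of the step factors over the
  super-geometric scale sequence is universally bounded ((3.54)).

## What is deliberately NOT here

* Lemma 3.4 itself ((3.45)–(3.46)) concerns `κₘ₋₁ = K̄ₘ^{κₘ}`, the homogenised matrix of the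
  specific correctors of §3.2; Step 2 of its proof (pp. 44–45) transfers (3.49) to `κₘ` through the
  one-step corrector estimate (3.40). That transfer is internal to the construction and is not
  transcribed (`-- TODO(general form)`: an abstract Step 2 for any sequence whose ratios
  `κₙ₋₁/κₙ` are within `1 ± C εₙ₋₁^{2δ}` of `1 + 9aₙ²εₙ⁴/(80κₙ²)`, (3.57)).
* The printed range in (3.45)/(3.49) is `m ∈ {0, …, M-1}`. With `ε₀ := 1` ((2.8)) the last step
  `m = 1 → 0` has `r₁ = ε₁^{β-γ} ≪ 1` instead of `r₁ ≈ 1`, so `κ'₀ ≍ ε₁^{β-γ}` and the two-sided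
  bound at `m = 0` cannot hold with constants independent of `Λ`; the cascade of §4–§5 only uses
  `m ≥ m_* ≥ 1` ((5.95) p. 90). We therefore prove (3.49) for `1 ≤ m ≤ M - 1` and record the
  endpoint here rather than weaken anything silently.
* (2.10) is stated in the paper for the concrete `εₘ` as "routine to check"; it is an hypothesis
  of `IsScaleSequence` here. `RenormalizedDiffusivityCascadeScales.lean` proves it for the printed
  `εₘ` (`scaleSeq`) when `q < 10` and `Λ ≥ max{2⁷, 10(q+1)/(10-q)}` (so for `q ≤ 9` whenever
  `Λ ≥ 2⁷`), proves the lower half and (2.9) unconditionally, and records that the printed upper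
  constant `10` cannot serve for `q ≥ 10` (`⟺ β ≤ 40/39` when `q = qExp β`): there the valid
  `q`-uniform form is `εₘ₊₁ ≤ (1 + 4q εₘ) εₘ^q` (`Λ ≥ 2q+2`), also proved there.

## References

* S. Armstrong, V. Vicol, *Anomalous diffusion by fractal homogenization*, Ann. PDE 11 (2025),
  no. 1, Paper No. 2 (doi:10.1007/s40818-024-00189-6; arXiv:2305.05048v3), §2.1 pp. 18–19,
  §3.3 pp. 42–45 (Lemma 3.4 p. 43, proof pp. 44–45). [`ArmstrongVicol2025`]
-/

open Real

namespace Literature.Analysis.FluidPDE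

namespace ArmstrongVicol2025

/-! ### The exponents of §2.1 -/

/-- The scale-separation exponent `q := ½ (1 + (2-β)/(2(β-1)))` of Armstrong–Vicol, for a stream
function regularity `β ∈ (1, 4/3)` (`α = β - 1` in Thm. 1.1): successive scales satisfy
`εₘ₊₁ ≃ εₘ^q`. [cite: ArmstrongVicol2025, §2.1 (2.2) p. 18] -/
noncomputable def qExp (β : ℝ) : ℝ := (1 + (2 - β) / (2 * (β - 1))) / 2

/-- The exponent `γ := (q-1)β/(q+1)`, the correction to the exponent of the renormalised
diffusivities in Lemma 3.4 (`κₘ ≃ aₘ εₘ^{2+γ} = εₘ^{β+γ}`).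
[cite: ArmstrongVicol2025, §2.1 (2.7) p. 18] -/
noncomputable def gammaExp (β q : ℝ) : ℝ := (q - 1) * β / (q + 1)

/-- The small exponent `δ := ¼ (q-1) (1 - (2q+1)/(2q+2) β)`.
[cite: ArmstrongVicol2025, §2.1 (2.5) p. 18] -/
noncomputable def deltaExp (β q : ℝ) : ℝ := (q - 1) / 4 * (1 - (2 * q + 1) / (2 * q + 2) * β)

/-! ### The model recursion (3.47) -/

/-- The model one-step enhancement map `κ ↦ κ + 9 a² ε⁴ / (80 κ)`: the homogenised diffusivity of
the scale-`ε`, amplitude-`a` alternating shear flows run with diffusivity `κ`, up to the corrector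
error ("loosely … `K̄ₘ^κ ≈ κ + 9aₘ²εₘ⁴/(80κ)`").
[cite: ArmstrongVicol2025, §3.3 (3.41) p. 42 and (3.47) p. 43] -/
noncomputable def enhanceStep (a ε κ : ℝ) : ℝ := κ + 9 * a ^ 2 * ε ^ 4 / (80 * κ)

/-- `n` steps of the model recursion (3.47) down from the critical scale `M`:
`aux 0 = κ`, `aux (n+1) = enhanceStep a_{M-n} ε_{M-n} (aux n)` (so `aux n = κ'_{M-n}`); written
with the recursor (both equations hold by `rfl`). [cite: ArmstrongVicol2025, §3.3 (3.47) p. 43] -/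
noncomputable def modelDiffusivityAux (a ε : ℕ → ℝ) (M : ℕ) (κ : ℝ) (n : ℕ) : ℝ :=
  Nat.rec κ (fun j r => enhanceStep (a (M - j)) (ε (M - j)) r) n

/-- The model renormalised diffusivities (3.47): `κ'_M = κ` and
`κ'ₘ₋₁ = κ'ₘ + 9 aₘ² εₘ⁴ / (80 κ'ₘ)` for `m ∈ {1, …, M}` (for `m ≥ M` the value is `κ`).
[cite: ArmstrongVicol2025, §3.3 (3.47) p. 43] -/
noncomputable def modelDiffusivity (a ε : ℕ → ℝ) (M : ℕ) (κ : ℝ) (m : ℕ) : ℝ :=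
  modelDiffusivityAux a ε M κ (M - m)

/-! ### The scale sequence: (2.8)–(2.10) as hypotheses -/

/-- The printed properties of Armstrong–Vicol's length scales `εₘ⁻¹ := ⌈Λ^{q^m/(q-1)}⌉`, `ε₀ := 1`,
`Λ ∈ ℕ ∩ [2⁷, ∞)` ((2.8)): positivity, `ε₀ = 1`, the minimal scale separation
`εₘ/εₘ₊₁ ≥ Λ ≥ 2⁷` ((2.9)), and the super-geometric two-sided bound
`(1 - 10εₘ) εₘ^q ≤ εₘ₊₁ ≤ (1 + 10εₘ) εₘ^q` ((2.10), required here for `m ≥ 1` only, where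
`10 εₘ ≤ 10/128`). [cite: ArmstrongVicol2025, §2.1 (2.8)–(2.10) pp. 18–19] -/
structure IsScaleSequence (q : ℝ) (ε : ℕ → ℝ) : Prop where
  pos : ∀ m, 0 < ε m
  zero : ε 0 = 1
  ratio : ∀ m, 2 ^ 7 * ε (m + 1) ≤ ε m
  superGeometric : ∀ m, 1 ≤ m →
    (1 - 10 * ε m) * ε m ^ q ≤ ε (m + 1) ∧ ε (m + 1) ≤ (1 + 10 * ε m) * ε m ^ q

/-! ### The printed scale sequence (2.8) -/

/-- The real number `Λ^{q^m/(q-1)} = exp((q^m/(q-1)) log Λ)` whose integer ceiling is `εₘ⁻¹`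
((2.8)); it satisfies `scaleBase Λ q (m+1) = (scaleBase Λ q m)^q = scaleBase Λ q m · Λ^{q^m}`
(the factorisation behind (2.9)). [cite: ArmstrongVicol2025, §2.1 (2.8) p. 19] -/
noncomputable def scaleBase (Λ : ℕ) (q : ℝ) (m : ℕ) : ℝ := (Λ : ℝ) ^ (q ^ m / (q - 1))

/-- Armstrong–Vicol's length scales: `ε₀ := 1` and `εₘ⁻¹ := ⌈Λ^{q^m/(q-1)}⌉` for `m ∈ ℕ`
(`m ≥ 1`), for a minimal scale separation `Λ ∈ ℕ ∩ [2⁷, ∞)` and the exponent `q > 1` of (2.2).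
That this sequence has the properties (2.9)–(2.10) packaged in `IsScaleSequence` is proved in
`RenormalizedDiffusivityCascadeScales.lean` (`isScaleSequence_scaleSeq`, for `q < 10`).
[cite: ArmstrongVicol2025, §2.1 (2.8) p. 19] -/
noncomputable def scaleSeq (Λ : ℕ) (q : ℝ) (m : ℕ) : ℝ :=
  if m = 0 then 1 else 1 / (⌈scaleBase Λ q m⌉₊ : ℝ)

end ArmstrongVicol2025

end Literature.Analysis.FluidPDE
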